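import Summits.CriticalPhenomena.PercolationContinuityZ3.Theorems.PercNearOneGluingNoHeavyQuantGatedShiftPartial
import HarnessLib

/-!
# QUANT lane R8, T-DEC: THE ONE-LAYER GATED-SHIFT THEOREM — a flow of `gate_q μ` at layer `J` yields a flow of `gate_q(μ(· − 1))`
# at layer `J + 1`, for EVERY top-affordable law (part 3 of 3 for Conjecture R `LawDec.GatedShiftDEC`)

builds on p205010 (kernel theorem, internal audit signed; external expert review pending)

Support file (`--supports stmt-CriticalPhenomena-4575`), QUANT lane typer seat prim-quant-stmt (gen 26), rung R8 of
`run/shared/lean/prim/quant/LADDER.md`.  Theorems only, standard axioms, no sorries.  Uses part 1 (`…QuantFlowPieces`: partial flows,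
criterion E and the first-moment criterion in flow form, the rate bounds) and part 2 (`…QuantGatedShiftPartial`: the partial flow).

THE THEOREM (`LawDec.flowAtT_gatedShift_succ`).  `0 < y < 1`, `0 < q ≤ 1`, `y ≤ q`; `μ ≥ 0` a law on `{0..M}` of mass `1` with
`S = q·(mean μ)` and `y·M ≤ S`; `J < M`.  If `ν = gate_q μ` has a flow at `(y, S, J)` then `L = gate_q(μ(· − 1))` has a flow at
`(y, S + q, J + 1)`.  ONE hypothesis layer suffices and NO condition on the support of `μ` is needed (typer g25's transport needed the
stay condition "no charged mid above `S/q`"; lead g24's candidate asked for DEC of `μ` at every layer).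
THE PROOF.  Part 2 ships the nonzero lows of `L` by a partial flow `φ` into mids, each column loaded by at most what the `ν`-flow loaded,
and leaves a REMAINDER `A = L − φ` whose lows are the atom `0` (mass `1 − q`) and the unplaced parts of the nonzero lows.  Either the
slots were filled and the remaining low mass fits into the certified giant room (`flowAtT_of_giants`), or every nonzero low was fully
placed — then each placed pair, a mid pair at its minimal gate, has mean `≤ S + q` (`usage_mid_mul_le`, as `y·(M+1) ≤ S + q`), the law `L`
has mean exactly `S + q`, so `A` has mean `≥ S + q` with `0` its only low, and the first-moment criterion (`flowAtT_of_moment`) ships it.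
`isFlowAtT_of_partial` glues the two flows.  EVIDENCE before the proof (typer g26, exact): the explicit flow verified on 20 764 random
`(μ, x, q, j)`; Farkas scan `M ≤ 5`: 0 facets of the conclusion cone not implied by the single hypothesis layer.

* `LawDec.sum_moment_partial_nonpos` — a partial flow into mids at minimal gates lowers the first moment: `Σ_{a,k} φ a k·((a − T) +
  (k − T)·usage(a,k)) ≤ 0`.
* `LawDec.gate_shift_laws` — law facts of `gate (μ(· − 1)) q`: nonnegative, vanishing above `M + 1`, mass `1`, mean `q·(mean μ + 1)`.
* **`LawDec.flowAtT_gatedShift_succ`** — the theorem.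

[this work]; flow normal form / rates: this lane (typer g22, lead g21, typer g25).  The gluing rows served
[cite: KozmaNitzan2024, Conjecture 3 (p. 15)]; product measure [cite: Grimmett1999, §1.3 p. 10].
-/

noncomputable section

namespace Summit.CriticalPhenomena.PercolationContinuityZ3.Theorems

namespace Quant

open Finset

namespace LawDec

/-! ### Two generic pieces -/

/-- **a partial flow into mids lowers the first moment**: if `φ ≥ 0` charges only pairs `(a, k)` with `2a < T`, `k ≤ j`, `T < a + k`,
`y·k ≤ T` (`0 < y < 1`), then `Σ_{a ≤ j} Σ_{k ≤ M} ((a − T)·φ a k + (k − T)·usage(a,k)·φ a k) ≤ 0` (`usage_mid_mul_le`). [this work] -/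
theorem sum_moment_partial_nonpos (y T : ℝ) (j M : ℕ) (φ : ℕ → ℕ → ℝ) (hy0 : 0 < y) (hy1 : y < 1)
    (hφ0 : ∀ a k, 0 ≤ φ a k)
    (hφsupp : ∀ a k, 0 < φ a k → 2 * (a : ℝ) < T ∧ k ≤ j ∧ T < (a : ℝ) + k ∧ y * (k : ℝ) ≤ T) :
    ∑ a ∈ Finset.range (j + 1), ∑ k ∈ Finset.range (M + 1),
      (((a : ℝ) - T) * φ a k + ((k : ℝ) - T) * (usage y T j a k * φ a k)) ≤ 0 := by
  refine Finset.sum_nonpos fun a _ => Finset.sum_nonpos fun k _ => ?_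
  rcases (hφ0 a k).eq_or_lt with hz | hp
  · rw [← hz]; simp
  · obtain ⟨hlow, hkj, hcomp, hta⟩ := hφsupp a k hp
    have hu := usage_mid_mul_le y T j a k hy0 hy1 hlow hkj hcomp hta
    have e : ((a : ℝ) - T) * φ a k + ((k : ℝ) - T) * (usage y T j a k * φ a k)
        = φ a k * (((a : ℝ) - T) + usage y T j a k * ((k : ℝ) - T)) := by ring
    rw [e]
    exact mul_nonpos_of_nonneg_of_nonpos hp.le (by linarith)

/-- **law facts of the gated shift** `gate (μ(· − 1)) q` for a law `μ ≥ 0` on `{0..M}` of mass `1` and `0 ≤ q ≤ 1`: nonnegative, zero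
above `M + 1`, mass `1`, mean `q·(mean μ + 1)`; values `1 − q` at `0` and `q·μ h` at `h + 1`. [this work] -/
theorem gate_shift_laws (q : ℝ) (M : ℕ) (μ sh : ℕ → ℝ) (hq0 : 0 ≤ q) (hq1 : q ≤ 1) (hμ0 : ∀ h, 0 ≤ μ h)
    (hμM : ∀ h, M < h → μ h = 0) (hμ1 : ∑ h ∈ Finset.range (M + 1), μ h = 1)
    (hsh : ∀ t, sh t = if 1 ≤ t then μ (t - 1) else 0) :
    (∀ t, 0 ≤ gate sh q t) ∧ (∀ t, M + 1 < t → gate sh q t = 0) ∧ (∑ t ∈ Finset.range (M + 1 + 1), gate sh q t = 1) ∧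
      (∑ t ∈ Finset.range (M + 1 + 1), (t : ℝ) * gate sh q t = q * (∑ h ∈ Finset.range (M + 1), (h : ℝ) * μ h + 1)) ∧
      gate sh q 0 = 1 - q ∧ (∀ h, gate sh q (h + 1) = q * μ h) := by
  have s0 : ∀ t, 0 ≤ sh t := fun t => by rw [hsh]; split_ifs; exacts [hμ0 _, le_rfl]
  have sM : ∀ t, M + 1 < t → sh t = 0 := fun t ht => by
    rw [hsh]; split_ifs
    · exact hμM _ (by omega)
    · rfl
  have reindex : ∀ g : ℕ → ℝ, ∑ t ∈ Finset.range (M + 1 + 1), (if 1 ≤ t then g (t - 1) else 0)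
      = ∑ h ∈ Finset.range (M + 1), g h := by
    intro g
    rw [Finset.sum_range_succ']
    rw [if_neg (by omega), add_zero]
    exact Finset.sum_congr rfl fun h _ => by rw [if_pos (by omega), Nat.add_sub_cancel]
  have s1 : ∑ t ∈ Finset.range (M + 1 + 1), sh t = 1 := by
    rw [Finset.sum_congr rfl (fun t _ => hsh t), reindex, hμ1]
  have smean : ∑ t ∈ Finset.range (M + 1 + 1), (t : ℝ) * sh t = ∑ h ∈ Finset.range (M + 1), (h : ℝ) * μ h + 1 := by
    have e : ∀ t ∈ Finset.range (M + 1 + 1), (t : ℝ) * sh t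
        = (if 1 ≤ t then (((t - 1 : ℕ) : ℝ) + 1) * μ (t - 1) else 0) := by
      intro t _
      rw [hsh]
      split_ifs with ht
      · rw [show ((t - 1 : ℕ) : ℝ) + 1 = t by push_cast [Nat.cast_sub ht]; ring]
      · rw [mul_zero]
    rw [Finset.sum_congr rfl e, reindex (fun h => ((h : ℝ) + 1) * μ h)]
    simp only [add_mul, one_mul]
    rw [Finset.sum_add_distrib, hμ1]
  obtain ⟨L0nn, LM, L1⟩ := gate_laws (M + 1) sh q hq0 hq1 s0 sM s1
  refine ⟨L0nn, LM, L1, by rw [sum_mul_gate, smean], ?_, fun h => ?_⟩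
  · rw [gate_apply, hsh]; simp
  · rw [gate_apply, hsh, if_pos (by omega), if_neg (by omega), Nat.add_sub_cancel]; ring

/-! ### The one-layer gated-shift theorem -/

/-- **THE ONE-LAYER GATED-SHIFT THEOREM.**  `0 < y < 1`, `0 < q ≤ 1`, `y ≤ q`; `μ ≥ 0` on `{0..M}`, mass `1`, `S = q·mean μ`, `y·M ≤ S`,
`J < M`.  A flow of `gate μ q` at `(y, S, J)` on `{0..M}` yields a flow of `gate (μ(· − 1)) q` at `(y, S + q, J + 1)` on `{0..M+1}`.
See the file header. [this work] -/
theorem flowAtT_gatedShift_succ (y S q : ℝ) (J M : ℕ) (μ : ℕ → ℝ) (hy0 : 0 < y) (hy1 : y < 1)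
    (hq0 : 0 < q) (hq1 : q ≤ 1) (hyq : y ≤ q) (hμ0 : ∀ h, 0 ≤ μ h) (hμM : ∀ h, M < h → μ h = 0)
    (hμ1 : ∑ h ∈ Finset.range (M + 1), μ h = 1)
    (hS : S = q * ∑ h ∈ Finset.range (M + 1), (h : ℝ) * μ h) (hta : y * (M : ℝ) ≤ S) (hJM : J < M)
    (hF : FlowAtT y S J M (gate μ q)) :
    FlowAtT y (S + q) (J + 1) (M + 1) (gate (fun t => if 1 ≤ t then μ (t - 1) else 0) q) := by
  classical
  obtain ⟨f, hf⟩ := hF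
  have hfI : IsFlowAtT y S J M (gate μ q) f := hf
  obtain ⟨φ, hφ0, hφsupp, hφz, hcolφ, hrows, hdich⟩ :=
    gatedShift_partial y S q J M μ f hy0 hy1 hq0 hq1 hμ0 hta hJM hfI
  have hterm := hfI.term_nonneg hy0 hy1
  obtain ⟨hf0, hsupp, hrow, hcap⟩ := hf
  set T : ℝ := ∑ h ∈ Finset.range (M + 1), (h : ℝ) * μ h with hT
  set S' : ℝ := S + q with hS'
  set ν : ℕ → ℝ := gate μ q with hν
  set sh : ℕ → ℝ := fun t => if 1 ≤ t then μ (t - 1) else 0 with hsh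
  set L : ℕ → ℝ := gate sh q with hL
  /- ### scalars and law facts -/
  have h1y : 0 < 1 - y := by linarith
  have hM1 : (1 : ℝ) ≤ M := by exact_mod_cast (show 1 ≤ M by omega)
  have hSpos : 0 < S := by nlinarith
  have hS'pos : 0 < S' := by rw [hS']; linarith
  have htaL : ∀ k : ℕ, k ≤ M + 1 → y * (k : ℝ) ≤ S' := by
    intro k hk
    have : (k : ℝ) ≤ M + 1 := by exact_mod_cast hk
    rw [hS']
    nlinarith
  have hνpos : ∀ h, 1 ≤ h → ν h = q * μ h := fun h hh => by rw [hν, gate_apply, if_neg (by omega)]; ring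
  obtain ⟨L0nn, LM, L1, Lmean, hL0, hLsucc⟩ :=
    gate_shift_laws q M μ sh hq0.le hq1 hμ0 hμM hμ1 (fun t => by rw [hsh])
  have Lmean' : ∑ t ∈ Finset.range (M + 1 + 1), (t : ℝ) * L t = S' := by
    rw [hL, Lmean, hS', hS]; ring
  -- a used `ν`-column carries at least its `f`-load, in `L`-mass
  have hlh : ∀ l h, 0 < f l h → l < h := by
    intro l h hp
    obtain ⟨_, hlow, _, hadm⟩ := hsupp l h hp
    rcases hadm with h1 | h2
    · omega
    · by_contra hc
      have : (h : ℝ) ≤ l := by exact_mod_cast not_lt.1 hc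
      linarith [(Nat.cast_nonneg l : (0 : ℝ) ≤ l)]
  have hcapcol : ∀ m, m ≤ M → ∑ l ∈ Finset.range (J + 1), usage y S J l m * f l m ≤ L (m + 1) := by
    intro m hmM
    by_cases habs : J + 1 ≤ m ∨ S ≤ 2 * (m : ℝ)
    · by_cases hm0 : m = 0
      · subst hm0
        have : ∀ l ∈ Finset.range (J + 1), usage y S J l 0 * f l 0 = 0 := by
          intro l _
          rcases (hf0 l 0).eq_or_lt with hz | hp
          · rw [← hz, mul_zero]
          · exact absurd (hlh l 0 hp) (Nat.not_lt_zero l)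
        rw [Finset.sum_eq_zero this, hL, hLsucc]
        exact mul_nonneg hq0.le (hμ0 0)
      · rw [hL, hLsucc, ← hνpos m (Nat.one_le_iff_ne_zero.2 hm0)]
        exact hcap m hmM habs
    · have : ∀ l ∈ Finset.range (J + 1), usage y S J l m * f l m = 0 := by
        intro l _
        rcases (hf0 l m).eq_or_lt with hz | hp
        · rw [← hz, mul_zero]
        · exfalso
          obtain ⟨_, hlow, _, hadm⟩ := hsupp l m hp
          apply habs
          rcases hadm with h1 | h2
          · exact Or.inl h1
          · right; linarith [(Nat.cast_nonneg l : (0 : ℝ) ≤ l)]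
      rw [Finset.sum_eq_zero this, hL, hLsucc]
      exact mul_nonneg hq0.le (hμ0 m)
  /- ### the remainder -/
  set A : ℕ → ℝ := fun t => L t - ∑ k ∈ Finset.range (M + 1 + 1), φ t k
    - ∑ a ∈ Finset.range (J + 1 + 1), usage y S' (J + 1) a t * φ a t with hA
  -- column sums into a low atom and row sums out of a non-low vanish
  have hcol_low : ∀ t, t ≤ J + 1 → 2 * (t : ℝ) < S' →
      ∑ a ∈ Finset.range (J + 1 + 1), usage y S' (J + 1) a t * φ a t = 0 := by
    intro t htJ htlow
    refine Finset.sum_eq_zero fun a _ => ?_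
    rcases (hφ0 a t).eq_or_lt with hz | hp
    · rw [← hz, mul_zero]
    · exfalso
      obtain ⟨_, halow, _, hadm⟩ := hφsupp a t hp
      rcases hadm with h1 | h2
      · omega
      · linarith
  have hrow_abs : ∀ t, ¬ (1 ≤ t ∧ t ≤ J + 1 ∧ 2 * (t : ℝ) < S') → ∑ k ∈ Finset.range (M + 1 + 1), φ t k = 0 := by
    intro t ht
    exact Finset.sum_eq_zero fun k _ => hφz t k (fun hc => ht hc.1)
  have hA0val : A 0 = 1 - q := by
    simp only [hA]
    rw [hrow_abs 0 (fun h => absurd h.1 (by omega)), hL, hL0]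
    have : ∑ a ∈ Finset.range (J + 1 + 1), usage y S' (J + 1) a 0 * φ a 0 = 0 :=
      Finset.sum_eq_zero fun a _ => by rw [hφz a 0 (fun h => absurd h.2.1 (by omega)), mul_zero]
    rw [this]; ring
  have hAlow : ∀ a, (1 ≤ a ∧ a ≤ J + 1 ∧ 2 * (a : ℝ) < S') → A a = L a - ∑ k ∈ Finset.range (M + 1 + 1), φ a k := by
    intro a hla
    simp only [hA]
    rw [hcol_low a hla.2.1 hla.2.2, sub_zero]
  have hAgiant : ∀ t, J + 1 + 1 ≤ t → A t = L t := by
    intro t ht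
    simp only [hA]
    rw [hrow_abs t (fun h => absurd h.2.1 (by omega))]
    have : ∑ a ∈ Finset.range (J + 1 + 1), usage y S' (J + 1) a t * φ a t = 0 :=
      Finset.sum_eq_zero fun a _ => by rw [hφz a t (fun hc => absurd hc.2.2 (by omega)), mul_zero]
    rw [this]; ring
  have hA_nn : ∀ t, 0 ≤ A t := by
    intro t
    by_cases ht0 : t = 0
    · rw [ht0, hA0val]; linarith
    by_cases hlt : (1 ≤ t ∧ t ≤ J + 1 ∧ 2 * (t : ℝ) < S')
    · rw [hAlow t hlt]; linarith [hrows t hlt]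
    obtain ⟨m, rfl⟩ : ∃ m, t = m + 1 := ⟨t - 1, by omega⟩
    by_cases hmJ : m ≤ J
    · simp only [hA]
      rw [hrow_abs (m + 1) hlt, sub_zero]
      have h1 := hcolφ m hmJ
      have h2 := hcapcol m (by omega)
      linarith
    · rw [hAgiant (m + 1) (by omega), hL]
      exact L0nn (m + 1)
  /- ### the remainder has a flow -/
  have hAflow : FlowAtT y S' (J + 1) (M + 1) A := by
    rcases hdich with hgiants | hplaced
    · -- every remaining low rides the giants
      refine flowAtT_of_giants y S' (J + 1) (M + 1) A hy0 hy1 hA_nn ?_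
      have hlhs : ∑ l ∈ Finset.range (J + 1 + 1), (if 2 * (l : ℝ) < S' then A l else 0)
          = (1 - q) + ∑ a ∈ Finset.range (J + 1 + 1),
              (if (1 ≤ a ∧ a ≤ J + 1 ∧ 2 * (a : ℝ) < S') then L a - ∑ k ∈ Finset.range (M + 1 + 1), φ a k else 0) := by
        rw [Finset.sum_range_succ', Finset.sum_range_succ' (fun a =>
          (if (1 ≤ a ∧ a ≤ J + 1 ∧ 2 * (a : ℝ) < S') then L a - ∑ k ∈ Finset.range (M + 1 + 1), φ a k else 0))]
        simp only [Nat.cast_zero, mul_zero]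
        rw [if_pos hS'pos, hA0val, if_neg (fun h => absurd h.1 (by omega)), add_zero]
        have e : ∀ l ∈ Finset.range (J + 1), (if 2 * (((l + 1 : ℕ)) : ℝ) < S' then A (l + 1) else 0)
            = (if (1 ≤ l + 1 ∧ l + 1 ≤ J + 1 ∧ 2 * (((l + 1 : ℕ)) : ℝ) < S') then
                L (l + 1) - ∑ k ∈ Finset.range (M + 1 + 1), φ (l + 1) k else 0) := by
          intro l hl
          rw [Finset.mem_range] at hl
          by_cases hc : 2 * (((l + 1 : ℕ)) : ℝ) < S'
          · have hla : 1 ≤ l + 1 ∧ l + 1 ≤ J + 1 ∧ 2 * (((l + 1 : ℕ)) : ℝ) < S' := ⟨by omega, by omega, hc⟩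
            rw [if_pos hc, if_pos hla, hAlow (l + 1) hla]
          · rw [if_neg hc, if_neg (fun h => hc h.2.2)]
        rw [Finset.sum_congr rfl e]; ring
      have hrhs : ∑ h ∈ Finset.Ico (J + 1 + 1) (M + 1 + 1), A h = ∑ h ∈ Finset.Ico (J + 1) (M + 1), ν h := by
        calc ∑ h ∈ Finset.Ico (J + 1 + 1) (M + 1 + 1), A h
            = ∑ h ∈ Finset.Ico (J + 1 + 1) (M + 1 + 1), L h :=
              Finset.sum_congr rfl fun h hh => hAgiant h (Finset.mem_Ico.1 hh).1
          _ = ∑ h ∈ Finset.Ico (J + 1) (M + 1), L (h + 1) := (Finset.sum_Ico_add' L (J + 1) (M + 1) 1).symm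
          _ = ∑ h ∈ Finset.Ico (J + 1) (M + 1), ν h :=
              Finset.sum_congr rfl fun h hh => by
                rw [hL, hLsucc, hνpos h (by have := (Finset.mem_Ico.1 hh).1; omega)]
      rw [hlhs, hrhs]
      exact hgiants
    · -- every nonzero low is placed: the first-moment criterion ships the atom `0`
      refine flowAtT_of_moment y S' (J + 1) (M + 1) A hy0 hy1 hS'pos hA_nn ?_ (htaL (M + 1) le_rfl) ?_
      · intro l hl1 hlJ hllow
        rw [hAlow l ⟨hl1, hlJ, hllow⟩, hplaced l ⟨hl1, hlJ, hllow⟩]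
        ring
      · have hLpart : ∑ t ∈ Finset.range (M + 1 + 1), ((t : ℝ) - S') * L t = 0 := by
          have e : ∑ t ∈ Finset.range (M + 1 + 1), ((t : ℝ) - S') * L t
              = ∑ t ∈ Finset.range (M + 1 + 1), (t : ℝ) * L t - S' * ∑ t ∈ Finset.range (M + 1 + 1), L t := by
            rw [Finset.mul_sum, ← Finset.sum_sub_distrib]
            exact Finset.sum_congr rfl fun t _ => by ring
          have hL1' : ∑ t ∈ Finset.range (M + 1 + 1), L t = 1 := L1
          rw [e, Lmean', hL1']; ring
        have hrowpart : ∑ t ∈ Finset.range (M + 1 + 1), ((t : ℝ) - S') * ∑ k ∈ Finset.range (M + 1 + 1), φ t k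
            = ∑ a ∈ Finset.range (J + 1 + 1), ∑ k ∈ Finset.range (M + 1 + 1), ((a : ℝ) - S') * φ a k := by
          have hsub : ∑ a ∈ Finset.range (J + 1 + 1), ((a : ℝ) - S') * ∑ k ∈ Finset.range (M + 1 + 1), φ a k
              = ∑ t ∈ Finset.range (M + 1 + 1), ((t : ℝ) - S') * ∑ k ∈ Finset.range (M + 1 + 1), φ t k :=
            Finset.sum_subset (Finset.range_mono (show J + 1 + 1 ≤ M + 1 + 1 by omega)) (fun t _ ht => by
              rw [Finset.mem_range] at ht
              rw [hrow_abs t (fun h => absurd h.2.1 (by omega)), mul_zero])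
          rw [← hsub]
          exact Finset.sum_congr rfl fun a _ => by rw [Finset.mul_sum]
        have hcolpart : ∑ t ∈ Finset.range (M + 1 + 1), ((t : ℝ) - S') *
              ∑ a ∈ Finset.range (J + 1 + 1), usage y S' (J + 1) a t * φ a t
            = ∑ a ∈ Finset.range (J + 1 + 1), ∑ k ∈ Finset.range (M + 1 + 1),
                ((k : ℝ) - S') * (usage y S' (J + 1) a k * φ a k) := by
          have e : ∀ t ∈ Finset.range (M + 1 + 1), ((t : ℝ) - S') *
              ∑ a ∈ Finset.range (J + 1 + 1), usage y S' (J + 1) a t * φ a t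
              = ∑ a ∈ Finset.range (J + 1 + 1), ((t : ℝ) - S') * (usage y S' (J + 1) a t * φ a t) :=
            fun t _ => by rw [Finset.mul_sum]
          rw [Finset.sum_congr rfl e, Finset.sum_comm]
        have hneg := sum_moment_partial_nonpos y S' (J + 1) (M + 1) φ hy0 hy1 hφ0 (fun a k hp => by
          obtain ⟨_, halow, hkM1, hadm⟩ := hφsupp a k hp
          have hkJ : k ≤ J + 1 := by
            by_contra hc
            exact absurd (hφz a k (fun h => hc h.2.2)) (ne_of_gt hp)
          have hcomp : S' < (a : ℝ) + k := by
            rcases hadm with h1 | h2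
            · omega
            · exact h2
          exact ⟨halow, hkJ, hcomp, htaL k hkM1⟩)
        rw [Finset.sum_congr rfl (fun a _ => Finset.sum_add_distrib), Finset.sum_add_distrib] at hneg
        have hexp : ∑ t ∈ Finset.range (M + 1 + 1), ((t : ℝ) - S') * A t
            = ∑ t ∈ Finset.range (M + 1 + 1), ((t : ℝ) - S') * L t
              - ∑ t ∈ Finset.range (M + 1 + 1), ((t : ℝ) - S') * ∑ k ∈ Finset.range (M + 1 + 1), φ t k
              - ∑ t ∈ Finset.range (M + 1 + 1), ((t : ℝ) - S') *
                  ∑ a ∈ Finset.range (J + 1 + 1), usage y S' (J + 1) a t * φ a t := by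
          rw [← Finset.sum_sub_distrib, ← Finset.sum_sub_distrib]
          exact Finset.sum_congr rfl fun t _ => by simp only [hA]; ring
        have hfin : 0 ≤ ∑ t ∈ Finset.range (M + 1 + 1), ((t : ℝ) - S') * A t := by
          rw [hexp, hLpart, hrowpart, hcolpart]; linarith
        have e2 : ∑ t ∈ Finset.range (M + 1 + 1), ((t : ℝ) - S') * A t
            = ∑ t ∈ Finset.range (M + 1 + 1), (t : ℝ) * A t - S' * ∑ t ∈ Finset.range (M + 1 + 1), A t := by
          rw [Finset.mul_sum, ← Finset.sum_sub_distrib]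
          exact Finset.sum_congr rfl fun t _ => by ring
        rw [e2] at hfin
        linarith
  /- ### assembly -/
  obtain ⟨g, hg⟩ := hAflow
  have hgI : IsFlowAtT y S' (J + 1) (M + 1) A g := hg
  rw [hA] at hgI
  exact ⟨fun l h => φ l h + g l h, isFlowAtT_of_partial hφ0 hφsupp hgI⟩

end LawDec

end Quant

end Summit.CriticalPhenomena.PercolationContinuityZ3.Theorems
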